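import Mathlib.Analysis.Calculus.BumpFunction.InnerProduct
import Literature.Analysis.FluidPDE.TaoAveragedComplexAverage
import Literature.Analysis.FluidPDE.TaoAveragedConjugation
import HarnessLib

/-!
# Tao 2016, §3.2–§3.4: the objects of the reduction of Theorem 3.2 to a single frequency scale

T. Tao, *Finite time blowup for an averaged three-dimensional Navier–Stokes equation*,
J. Amer. Math. Soc. **29** (2016), 601–674 = arXiv:1402.0290v3 (held as `paper:arxiv-1402.0290`;
all numbers are those of that text), §3.2 (second step: frequency localisation), §3.3 (third
step: forcing frequency comparability), §3.4 (fourth step: localising to a single frequency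
scale), pp. 15–17.

The named fact `Literature.Analysis.FluidPDE.Tao2016.localCascade_isComplexAverage`
(`TaoAveragedComplexAverage.lean`; every local cascade operator is a complex average of the
Euler bilinear operator `B`, §3.2–§3.9) is the remaining crux of Theorem 3.2. This file fixes,
as honest definitions, the objects in terms of which §3.2–§3.4 reduce it to the single-scale,
dilation-free representation (3.9) that §3.5–§3.9 then establish:

* `cplxCascadeWavelet`, `cplxBasicCascadeForm` — the **complexified basic local cascade
  operator (3.6)** `⟨C(u,v), w⟩ = Σₙ (1+ε₀)^{5n/2} ⟨u, \overline{ψ_{1,n}}⟩ ⟨v, \overline{ψ_{2,n}}⟩ ⟨w, \overline{ψ_{3,n}}⟩`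
  for complex Schwartz profiles `ψⱼ : ℝ³ → ℂ³`, and `HasBallFourierSupport` — "`ψ̂ⱼ` supported
  on the ball `B(ξⱼ⁰, ε₀³)`";
* `xi0` — the **normalised base frequencies (3.7)** `ξ₁⁰ = (0,1,0)`, `ξ₂⁰ = (-1,-1,0)`,
  `ξ₃⁰ = (1,0,0)` with `ξ₁⁰ + ξ₂⁰ + ξ₃⁰ = 0` (`xi0_sum`);
* `freqCutoff` — the smooth `φ : ℝ → ℝ` "supported on `[-2,2]` that equals one on `[-1,1]`" (§3.3),
  here a Mathlib `ContDiffBump`; `eta` — `η(N₁,N₂,N₃) = Π_{j=2,3} φ((N_j/N₁ - |ξⱼ⁰|/|ξ₁⁰|)/(10ε₀²))`;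
* `betaForm` — the frequency-comparable Euler form `B_η` **by its symbol**
  `⟨B_η(u,v), w⟩ = -πi ∫_{ξ₁+ξ₂+ξ₃=0} η(|ξ₁|,|ξ₂|,|ξ₃|) Λ(û(ξ₁), v̂(ξ₂), ŵ(ξ₃))` (the conclusion
  of §3.3; that this is a complex average of `B`, via the imaginary-order operators `D^{it}`,
  is the content of §3.3 and is *not* asserted here);
* `rho` — `ρ(ξ) = Σₙ φ(|(1+ε₀)^{-n}ξ - ξ₁⁰|/ε₀²)`; `betaRhoForm` — `B_{η,ρ}` by its symbol
  `ρ(ξ₁) η Λ`; `betaRhoScaleForm n` — `B_{η,ρ,n}` (p. 16), so that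
  `B_{η,ρ} = -πi Σₙ (1+ε₀)^{5n/2} B_{η,ρ,n}`;
* `singleScaleForm` — `C₀` of (3.8), `⟨C₀(u,v), w⟩ = ⟨u, ψ̄₁⟩ ⟨v, ψ̄₂⟩ ⟨w, ψ̄₃⟩`;
* `IsComplexAverageNoDilOf` — "complex average … (without the use of dilation operators)",
  the shape of (3.9).

Design: as in `TaoAveragedSobolev.lean`, operators `H¹⁰_df ⊗ ℂ × H¹⁰_df ⊗ ℂ → (H¹⁰_df)* ⊗ ℂ`
are their trilinear forms `L2C → L2C → L2C → ℂ`; Bochner / `tsum` junk `0` outside the regime of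
absolute convergence (arguments in `H¹⁰_df ⊗ ℂ`, Tao p. 14 and p. 16). The named facts for the
individual steps (§3.2 closure and transitivity, §3.3, §3.4, §3.5–3.9) and the assembly of
`localCascade_isComplexAverage` from them are the next layer and live in a separate file.

## References

* T. Tao, J. Amer. Math. Soc. 29 (2016), 601–674, arXiv:1402.0290v3, §3.2–§3.4 pp. 15–17,
  (3.6)–(3.9). Key `Tao2016AveragedNS`.
-/

noncomputable section

open MeasureTheory Set Filter FourierTransform
open scoped ENNReal NNReal SchwartzMap ComplexConjugate

namespace Literature.Analysis.FluidPDE.Tao2016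

/-- Local notation for physical / frequency space `ℝ³`. -/
local notation "ℝ³" => EuclideanSpace ℝ (Fin 3)
/-- Local notation for the complexified range `ℂ³`. -/
local notation "ℂ³" => EuclideanSpace ℂ (Fin 3)

/-! ### (3.6): complexified basic local cascade operators -/

/-- The Fourier transform of the complex Schwartz field `ψ : ℝ³ → ℂ³` is **supported in the
closed ball `B(ξ₀, r)`** (§3.2: "`ψ̂ⱼ` supported on the ball `B(ξⱼ⁰, ε₀³)`"): the Fourier
integral vanishes at every `ξ` with `dist ξ ξ₀ > r`. [cite: Tao2016AveragedNS, §3.2 p. 15] -/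
def HasBallFourierSupport (ξ₀ : ℝ³) (r : ℝ) (ψ : 𝓢(ℝ³, ℂ³)) : Prop :=
  ∀ ξ : ℝ³, r < dist ξ ξ₀ → 𝓕 (⇑ψ) ξ = 0

/-- The `L²`-rescaled complex wavelets `ψₙ(x) = (1+ε₀)^{3n/2} ψ((1+ε₀)ⁿ x)` of a complex Schwartz
profile (as in Def. 3.1, now complex-valued, §3.2). [cite: Tao2016AveragedNS, §3.2 (3.6)] -/
def cplxCascadeWavelet (ε₀ : ℝ) (ψ : 𝓢(ℝ³, ℂ³)) (n : ℤ) : L2C :=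
  dil ((1 + ε₀) ^ n) (ψ.toLp 2)

/-- The **complexified basic local cascade operator (3.6)**, Tao 2016 §3.2, by duality:
`⟨C(u,v), w⟩ = Σ_{n ∈ ℤ} (1+ε₀)^{5n/2} ⟨u, \overline{ψ_{1,n}}⟩ ⟨v, \overline{ψ_{2,n}}⟩ ⟨w, \overline{ψ_{3,n}}⟩`
with the complex *bilinear* pairing `⟨·,·⟩` (`pairing`) and complex conjugate wavelets
(`conjL2`); `tsum` junk `0` where the series does not converge (it converges absolutely for
`u, v, w ∈ H¹⁰_df ⊗ ℂ`, Tao p. 14). [cite: Tao2016AveragedNS, §3.2 (3.6)] -/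
def cplxBasicCascadeForm (ε₀ : ℝ) (ψ₁ ψ₂ ψ₃ : 𝓢(ℝ³, ℂ³)) (u v w : L2C) : ℂ :=
  ∑' n : ℤ, (((1 + ε₀) ^ ((5 : ℝ) * (n : ℝ) / 2) : ℝ) : ℂ) *
    (pairing u (conjL2 (cplxCascadeWavelet ε₀ ψ₁ n)) * pairing v (conjL2 (cplxCascadeWavelet ε₀ ψ₂ n)) *
      pairing w (conjL2 (cplxCascadeWavelet ε₀ ψ₃ n)))

/-- The **single-scale piece `C₀` of (3.8)**: `⟨C₀(u,v), w⟩ = ⟨u, ψ̄₁⟩ ⟨v, ψ̄₂⟩ ⟨w, ψ̄₃⟩`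
(the `n = 0` term; `Cₙ` is its conjugate by `Dil_{(1+ε₀)^{-n}}`). [cite: Tao2016AveragedNS, §3.4 (3.8)] -/
def singleScaleForm (ψ₁ ψ₂ ψ₃ : 𝓢(ℝ³, ℂ³)) (u v w : L2C) : ℂ :=
  pairing u (conjL2 (ψ₁.toLp 2)) * pairing v (conjL2 (ψ₂.toLp 2)) * pairing w (conjL2 (ψ₃.toLp 2))

/-- `⟨C(0,v), w⟩ = 0` for the complexified basic cascade form. [folklore] -/
theorem cplxBasicCascadeForm_zero_left (ε₀ : ℝ) (ψ₁ ψ₂ ψ₃ : 𝓢(ℝ³, ℂ³)) (v w : L2C) :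
    cplxBasicCascadeForm ε₀ ψ₁ ψ₂ ψ₃ 0 v w = 0 := by
  simp [cplxBasicCascadeForm, pairing_zero_left]

/-! ### (3.7): the normalised base frequencies -/

/-- The **normalisation (3.7)** of the base frequencies:
`ξ₁⁰ = (0,1,0)`, `ξ₂⁰ = (-1,-1,0)`, `ξ₃⁰ = (1,0,0)` (indexed by `Fin 3`). [cite: Tao2016AveragedNS, (3.7)] -/
def xi0 : Fin 3 → ℝ³ := ![!₂[0, 1, 0], !₂[-1, -1, 0], !₂[1, 0, 0]]

/-- `ξ₁⁰ + ξ₂⁰ + ξ₃⁰ = 0`, Tao's (3.7'): "the vanishing is convenient for technical reasons". [cite: Tao2016AveragedNS, §3.2 p. 16] -/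
theorem xi0_sum : xi0 0 + xi0 1 + xi0 2 = 0 := by
  ext i
  fin_cases i <;> simp [xi0]

/-- `|ξ₁⁰| = 1`. [cite: Tao2016AveragedNS, (3.7)] -/
theorem norm_xi0_zero : ‖xi0 0‖ = 1 := by
  simp [xi0, EuclideanSpace.norm_eq, Fin.sum_univ_three]

/-- `|ξ₂⁰| = √2`. [cite: Tao2016AveragedNS, (3.7)] -/
theorem norm_xi0_one : ‖xi0 1‖ = Real.sqrt 2 := by
  simp [xi0, EuclideanSpace.norm_eq, Fin.sum_univ_three]
  norm_num

/-- `|ξ₃⁰| = 1`; in particular the `ξⱼ⁰` "have distinct magnitudes" only as far as needed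
for (3.24) (`|ξ₂⁰| ≠ |ξ₁⁰| = |ξ₃⁰|`). [cite: Tao2016AveragedNS, (3.7)] -/
theorem norm_xi0_two : ‖xi0 2‖ = 1 := by
  simp [xi0, EuclideanSpace.norm_eq, Fin.sum_univ_three]

/-- The base frequencies are non-zero. [cite: Tao2016AveragedNS, §3.2 p. 15] -/
theorem xi0_ne_zero (j : Fin 3) : xi0 j ≠ 0 := by
  intro h
  have h' := congrArg (fun v : ℝ³ => ‖v‖) h
  fin_cases j
  · simp [norm_xi0_zero] at h'
  · simp [norm_xi0_one] at h'
  · simp [norm_xi0_two] at h'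

/-! ### §3.3: the freqCutoff `φ`, the comparability weight `η`, and `B_η` by its symbol -/

/-- Tao's freqCutoff "`φ : ℝ → ℝ` … a smooth function supported on `[-2,2]` that equals one on
`[-1,1]`" (§3.3), realised as a Mathlib bump function with radii `1 < 2`. [cite: Tao2016AveragedNS, §3.3 p. 16] -/
def freqCutoffBump : ContDiffBump (0 : ℝ) := ⟨1, 2, one_pos, one_lt_two⟩

/-- The freqCutoff `φ` as a function. [cite: Tao2016AveragedNS, §3.3 p. 16] -/
def freqCutoff (t : ℝ) : ℝ := freqCutoffBump t

/-- `φ = 1` on `[-1,1]`. [cite: Tao2016AveragedNS, §3.3 p. 16] -/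
theorem freqCutoff_eq_one {t : ℝ} (ht : |t| ≤ 1) : freqCutoff t = 1 :=
  freqCutoffBump.one_of_mem_closedBall (by simpa [Real.dist_eq, freqCutoffBump] using ht)

/-- `φ = 0` off `(-2,2)`. [cite: Tao2016AveragedNS, §3.3 p. 16] -/
theorem freqCutoff_eq_zero {t : ℝ} (ht : 2 ≤ |t|) : freqCutoff t = 0 :=
  freqCutoffBump.zero_of_le_dist (by simpa [Real.dist_eq, freqCutoffBump] using ht)

/-- `0 ≤ φ ≤ 1`. [folklore] -/
theorem freqCutoff_nonneg (t : ℝ) : 0 ≤ freqCutoff t := freqCutoffBump.nonneg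

/-- `0 ≤ φ ≤ 1`. [folklore] -/
theorem freqCutoff_le_one (t : ℝ) : freqCutoff t ≤ 1 := freqCutoffBump.le_one

/-- `φ` is smooth. [cite: Tao2016AveragedNS, §3.3 p. 16] -/
theorem contDiff_freqCutoff {n : ℕ∞} : ContDiff ℝ n freqCutoff := freqCutoffBump.contDiff

/-- The **frequency-comparability weight** of §3.3:
`η(N₁,N₂,N₃) = Π_{j=2,3} φ((N_j/N₁ - |ξⱼ⁰|/|ξ₁⁰|)/(10 ε₀²))`, "only non-vanishing when
`ξ₁, ξ₂, ξ₃` have comparable magnitude". [cite: Tao2016AveragedNS, §3.3 p. 16] -/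
def eta (ε₀ : ℝ) (N₁ N₂ N₃ : ℝ) : ℝ :=
  freqCutoff ((N₂ / N₁ - ‖xi0 1‖ / ‖xi0 0‖) / (10 * ε₀ ^ 2)) *
    freqCutoff ((N₃ / N₁ - ‖xi0 2‖ / ‖xi0 0‖) / (10 * ε₀ ^ 2))

/-- The **frequency-comparable Euler form `B_η` by its symbol** (§3.3, the displayed formula
after "we see that"): `⟨B_η(u,v), w⟩ = -πi ∫_{ξ₁+ξ₂+ξ₃=0} η(|ξ₁|,|ξ₂|,|ξ₃|) Λ_{ξ₁,ξ₂,ξ₃}(û(ξ₁), v̂(ξ₂), ŵ(ξ₃))`.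
Tao *defines* `B_η` as the `D^{it}`-average `∫∫ ⟨B(D^{-it₂-it₃}u, D^{it₂}v), D^{it₃}w⟩ φ(t₂,t₃) dt₂dt₃`
and derives this formula by Fubini; the formula is taken as the definition here and the
averaging representation is the content of the §3.3 named fact. Bochner junk `0`. [cite: Tao2016AveragedNS, §3.3 p. 16] -/
def betaForm (ε₀ : ℝ) (u v w : L2C) : ℂ :=
  -(Real.pi * Complex.I) *
    ∫ p : ℝ³ × ℝ³, ((eta ε₀ ‖p.1‖ ‖p.2‖ ‖-p.1 - p.2‖ : ℝ) : ℂ) *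
      Λ p.1 p.2 (fourierFn u p.1) (fourierFn v p.2) (fourierFn w (-p.1 - p.2))

/-- The **scale-localising symbol `ρ`** of §3.3:
`ρ(ξ) = Σ_{n ∈ ℤ} φ(|(1+ε₀)^{-n} ξ - ξ₁⁰| / ε₀²)`, "supported on the union of the balls
`(1+ε₀)ⁿ · B(ξ₁⁰, 2ε₀²)`" (Tao writes `φ(ε₀⁻²((1+ε₀)^{-n}ξ₁ - ξ₁⁰))` for the radial freqCutoff).
`tsum` junk `0` where not summable (for `0 < ε₀ < 1` at most finitely many terms are non-zero
at each `ξ`). [cite: Tao2016AveragedNS, §3.3 p. 16] -/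
def rho (ε₀ : ℝ) (ξ : ℝ³) : ℝ :=
  ∑' n : ℤ, freqCutoff (‖((1 + ε₀) ^ (-n) : ℝ) • ξ - xi0 0‖ / ε₀ ^ 2)

/-- **`B_{η,ρ}` by its symbol**: `B_{η,ρ}(u,v) = B_η(ρ(D)u, v)` (§3.3), i.e.
`⟨B_{η,ρ}(u,v), w⟩ = -πi ∫ ρ(ξ₁) η(|ξ₁|,|ξ₂|,|ξ₃|) Λ(û(ξ₁), v̂(ξ₂), ŵ(ξ₃))` since
`\widehat{ρ(D)u} = ρ û`. [cite: Tao2016AveragedNS, §3.3 p. 16] -/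
def betaRhoForm (ε₀ : ℝ) (u v w : L2C) : ℂ :=
  -(Real.pi * Complex.I) *
    ∫ p : ℝ³ × ℝ³, ((rho ε₀ p.1 * eta ε₀ ‖p.1‖ ‖p.2‖ ‖-p.1 - p.2‖ : ℝ) : ℂ) *
      Λ p.1 p.2 (fourierFn u p.1) (fourierFn v p.2) (fourierFn w (-p.1 - p.2))

/-! ### §3.4: the single-scale forms `B_{η,ρ,n}` and the dilation-free averages (3.9) -/

/-- **`B_{η,ρ,n}`** (§3.4, p. 16):
`⟨B_{η,ρ,n}(u,v), w⟩ = (1+ε₀)^{-5n/2} ∫_{ξ₁+ξ₂+ξ₃=0} φ(|(1+ε₀)^{-n}ξ₁ - ξ₁⁰|/ε₀²) η(|ξ₁|,|ξ₂|,|ξ₃|) Λ(û(ξ₁), v̂(ξ₂), ŵ(ξ₃))`,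
so that `B_{η,ρ} = -πi Σₙ (1+ε₀)^{5n/2} B_{η,ρ,n}` (no factor `-πi` in `B_{η,ρ,n}`). [cite: Tao2016AveragedNS, §3.4 p. 16] -/
def betaRhoScaleForm (ε₀ : ℝ) (n : ℤ) (u v w : L2C) : ℂ :=
  (((1 + ε₀) ^ (-(5 : ℝ) * (n : ℝ) / 2) : ℝ) : ℂ) *
    ∫ p : ℝ³ × ℝ³,
      ((freqCutoff (‖((1 + ε₀) ^ (-n) : ℝ) • p.1 - xi0 0‖ / ε₀ ^ 2) *
          eta ε₀ ‖p.1‖ ‖p.2‖ ‖-p.1 - p.2‖ : ℝ) : ℂ) *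
        Λ p.1 p.2 (fourierFn u p.1) (fourierFn v p.2) (fourierFn w (-p.1 - p.2))

/-- **`B_{η,ρ,0}`**, the single-scale target of (3.9). [cite: Tao2016AveragedNS, §3.4 (3.9)] -/
def betaRhoZeroForm (ε₀ : ℝ) (u v w : L2C) : ℂ := betaRhoScaleForm ε₀ 0 u v w

/-- `B_{η,ρ,0}` unfolded: the prefactor is `1`. [cite: Tao2016AveragedNS, §3.4 p. 16] -/
theorem betaRhoZeroForm_eq (ε₀ : ℝ) (u v w : L2C) :
    betaRhoZeroForm ε₀ u v w =
      ∫ p : ℝ³ × ℝ³, ((freqCutoff (‖p.1 - xi0 0‖ / ε₀ ^ 2) * eta ε₀ ‖p.1‖ ‖p.2‖ ‖-p.1 - p.2‖ : ℝ) : ℂ) *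
        Λ p.1 p.2 (fourierFn u p.1) (fourierFn v p.2) (fourierFn w (-p.1 - p.2)) := by
  simp [betaRhoZeroForm, betaRhoScaleForm]

/-- **Complex average without dilations** (§3.4: "a complex average of `B_{η,ρ,0}` (without the
use of dilation operators), thus (3.9)"): a complex averaging datum all of whose dilation
factors are `1`, reproducing `C` from `C'` on `H¹⁰_df ⊗ ℂ`. [cite: Tao2016AveragedNS, §3.4 (3.9)] -/
def IsComplexAverageNoDilOf (C C' : L2C → L2C → L2C → ℂ) : Prop :=
  ∃ 𝒟 : ComplexAveragingDatum, (∀ i θ, 𝒟.lam i θ = 1) ∧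
    ∀ u v w, MemH10dfC u → MemH10dfC v → MemH10dfC w → C u v w = 𝒟.average C' u v w

/-- A dilation-free complex average is a complex average. [cite: Tao2016AveragedNS, Def. 3.4 and (3.9)] -/
theorem IsComplexAverageNoDilOf.isComplexAverageOf {C C' : L2C → L2C → L2C → ℂ}
    (h : IsComplexAverageNoDilOf C C') : IsComplexAverageOf C C' := by
  obtain ⟨𝒟, -, h𝒟⟩ := h
  exact ⟨𝒟, h𝒟⟩

/-- **Non-vacuity**: `B` is a dilation-free complex average of itself (the Euler datum has
`λᵢ ≡ 1`). [folklore] -/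
theorem isComplexAverageNoDilOf_eulerForm_self : IsComplexAverageNoDilOf eulerForm eulerForm :=
  ⟨AveragingDatum.euler.toComplex, fun _ _ => rfl, fun u v w _ _ _ => by
    rw [AveragingDatum.toComplex_average_eulerForm, AveragingDatum.euler_form]⟩

end Literature.Analysis.FluidPDE.Tao2016
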